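import Literature.NumberTheory.Transcendental.BrownMotivicGaloisData
import Literature.NumberTheory.Transcendental.GoncharovFormalIteratedIntegralsProofs
import Literature.NumberTheory.Transcendental.AssociatorsAntipode
import HarnessLib

/-!
# Goncharov's coaction through a shuffle character is multiplicative (Brown 2012, Thm 2.4 / §2.4;
# Goncharov 2005, Prop. 2.2): the field `coaction_mul` of `Brown2012.MotivicGaloisData` DERIVED

`BrownMotivicGaloisData.lean` constructs Brown's package `MotivicMZV` from a Deligne–Goncharov-level
hypothesis bundle `MotivicGaloisData`. One of its fields, `coaction_mul` — "the coaction (2.5),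
written by Goncharov's formula (Theorem 2.4 (2.18)) through `ρ` and the reduction `Iᵐ(a;u;b) ↦
Iᵐ(0;u;1)` by I0, I1, I3, is a homomorphism for the shuffle product" — is a purely combinatorial
consequence of the other field `ρ_mul` (`ρ` is a shuffle character) and of Goncharov's theorem that
his coproduct respects the shuffle relations ([Goncharov2005, Prop. 2.2], in the tree as
`GoncharovFormalIteratedIntegrals.conv_shuffle`). This file proves it:

* `Brown2012.Im_mul`, `Brown2012.Im_path`: for ANY shuffle character `J` of `𝒪(₀Π₁) = ℚ⟨e⁰,e¹⟩`
  with values in a commutative `ℚ`-algebra, Brown's all-endpoints extension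
  `Iᵐ_J(a; u; b) := Im J a u b` (I0: `Iᵐ(a;u;a) = 0`, I1, I3: `Iᵐ(1;u;0) = (-1)^{|u|} Iᵐ(0;ũ;1)`)
  satisfies Goncharov's/Chen's relations (ii) shuffle
  `Iᵐ(a;u;b) Iᵐ(a;v;b) = Σ_{s ∈ u ш v} Iᵐ(a;s;b)` and (iii) path composition
  `Σ_{u = u₁u₂} Iᵐ(a;u₁;y) Iᵐ(y;u₂;b) = Iᵐ(a;u;b)` for all `a, y, b ∈ {0,1}` — the content of
  Brown's remark that (2.18) "can easily be rewritten in terms of `𝒪(₀Π₁)` only" [Brown2012, §2.4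
  after I3]. The case `a = b ≠ y` of (iii) is the antipode
  identity of the shuffle Hopf algebra (`NCSeries.sum_splits_shPair_reverse`), which needs the
  reversal symmetry of shuffles `ũ ш ṽ = (u ш v)~` (`MZV.shuffleWord_reverse_perm`, proved here by
  counting in the completed shuffle algebra `ShuffleAlgebra α ℤ`).
* `Brown2012.coactionG_eq_conv`: `coactionG ρ` IS Goncharov's composite `conv J K` of the tree
  (`GoncharovFormalIteratedIntegralsProofs.lean`) for the families `J = Iᵐ_e` (the word itself,
  `e_c ⊗ 1 ∈ 𝒰 ⊗ 𝒪(₀Π₁)`) and `K = Iᵐ_ρ` (through `algebraMap 𝒰 (𝒰 ⊗ 𝒪(₀Π₁))`).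
* `Brown2012.coactionG_mul`: hence, for a shuffle character `ρ`, `coactionG ρ` is multiplicative
  ([Goncharov2005, Prop. 2.2] via `conv_shuffle`), and `MotivicGaloisData.mk'` builds the bundle
  without the field `coaction_mul`.

## References

* F. Brown, *Mixed Tate motives over ℤ*, Ann. of Math. (2) **175** (2012), no. 2, 949–976,
  §2.1 (2.5)–(2.6), §2.4 I0–I3, Theorem 2.4 (2.18); arXiv:1102.1312. [Brown2012] [BrownMTM2012]
* A. B. Goncharov, *Galois symmetries of fundamental groupoids and noncommutative geometry*, Duke
  Math. J. **128** (2005), 209–284, §2.1, Prop. 2.2, Thm. 2.5. [Goncharov2005]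
* C. Reutenauer, *Free Lie Algebras*, London Math. Soc. Monographs 7, Oxford (1993), §1.4–1.6
  (shuffle Hopf algebra, antipode `S(w) = (-1)^{|w|} w̃`). [Reutenauer1993]
-/

noncomputable section

open scoped BigOperators

namespace Literature.NumberTheory.Transcendental

/-! ## Reversal symmetry of the shuffle product of words -/

namespace MZV

variable {α : Type*}

/-- Counting a word `t c` among words of the form `s a`. [folklore] -/
theorem count_map_append_singleton [DecidableEq α] (L : List (List α)) (t : List α) (a c : α) :
    (L.map (· ++ [a])).count (t ++ [c]) = if c = a then L.count t else 0 := by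
  split_ifs with h
  · subst h
    exact List.count_map_of_injective L (· ++ [c]) (List.append_left_injective [c]) t
  · refine List.count_eq_zero.2 fun hmem => h ?_
    obtain ⟨s, -, hs⟩ := List.mem_map.1 hmem
    exact (List.singleton_inj.1 (List.append_inj' hs rfl).2).symm

/-- **The shuffle recursion from the right**: `(u a) ш (v b) = ((u ш v b)) a + ((u a ш v)) b` as
multisets of words (dual to `shuffleWord_cons_cons`; proved by counting with the derivation
`∂_c` "remove the final letter" of the completed shuffle algebra). [cite: Reutenauer1993, §1.4] -/
theorem shuffleWord_append_singleton_perm (u v : List α) (a b : α) :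
    (shuffleWord (u ++ [a]) (v ++ [b])).Perm
      ((shuffleWord u (v ++ [b])).map (· ++ [a]) ++ (shuffleWord (u ++ [a]) v).map (· ++ [b])) := by
  classical
  rw [List.perm_iff_count]
  intro t
  have key : ∀ (x y t : List α), ((shuffleWord x y).count t : ℤ) =
      (ShuffleAlgebra.word x * ShuffleAlgebra.word y : ShuffleAlgebra α ℤ) t := fun x y t => by
    rw [ShuffleAlgebra.word_mul_word, ShuffleAlgebra.list_sum_map_word_apply]
  induction t using List.reverseRecOn with
  | nil =>
    rw [List.count_eq_zero.2, List.count_eq_zero.2]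
    · simp
    · intro hmem
      have := length_of_mem_shuffleWord _ _ hmem
      simp at this
  | append_singleton t c _ =>
    have hl := key (u ++ [a]) (v ++ [b]) (t ++ [c])
    rw [← ShuffleAlgebra.dEnd_apply, ShuffleAlgebra.dEnd_mul, ShuffleAlgebra.add_apply] at hl
    have hda : ShuffleAlgebra.dEnd c (ShuffleAlgebra.word (u ++ [a]) : ShuffleAlgebra α ℤ) =
        if c = a then ShuffleAlgebra.word u else 0 := by
      split_ifs with h
      · subst h; exact ShuffleAlgebra.dEnd_word_append c u
      · exact ShuffleAlgebra.dEnd_word_of_ne c (by simpa using fun h' => h h'.symm)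
    have hdb : ShuffleAlgebra.dEnd c (ShuffleAlgebra.word (v ++ [b]) : ShuffleAlgebra α ℤ) =
        if c = b then ShuffleAlgebra.word v else 0 := by
      split_ifs with h
      · subst h; exact ShuffleAlgebra.dEnd_word_append c v
      · exact ShuffleAlgebra.dEnd_word_of_ne c (by simpa using fun h' => h h'.symm)
    rw [hda, hdb] at hl
    have : ((shuffleWord (u ++ [a]) (v ++ [b])).count (t ++ [c]) : ℤ) =
        ((if c = a then (shuffleWord u (v ++ [b])).count t else 0 : ℕ) : ℤ) +
          ((if c = b then (shuffleWord (u ++ [a]) v).count t else 0 : ℕ) : ℤ) := by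
      rw [hl]
      congr 1
      · split_ifs
        · rw [key]
        · simp
      · split_ifs
        · rw [key]
        · simp
    rw [List.count_append, count_map_append_singleton, count_map_append_singleton]
    exact_mod_cast this

/-- **Reversal is an anti-automorphism of the shuffle product of words** (as multisets):
`ũ ш ṽ` is `u ш v` with every word reversed. [cite: Reutenauer1993, §1.4] -/
theorem shuffleWord_reverse_perm : ∀ (u v : List α),
    (shuffleWord u.reverse v.reverse).Perm ((shuffleWord u v).map List.reverse)
  | [], v => by simp
  | a :: u, [] => by simp
  | a :: u, b :: v => by
    have h1 := (shuffleWord_reverse_perm u (b :: v)).map (· ++ [a])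
    have h2 := (shuffleWord_reverse_perm (a :: u) v).map (· ++ [b])
    rw [List.reverse_cons] at h1 h2
    rw [List.reverse_cons, List.reverse_cons, shuffleWord_cons_cons, List.map_append, List.map_map,
      List.map_map]
    refine (shuffleWord_append_singleton_perm _ _ a b).trans ?_
    refine (h1.append h2).trans (List.Perm.of_eq ?_)
    rw [List.map_map, List.map_map]
    congr 1 <;> exact List.map_congr_left fun s _ => List.reverse_cons.symm

end MZV

namespace Brown2012

open MZV ShuffleMonoidAlgebra

/-! ## Brown's `Iᵐ(a; u; b)` through a shuffle character satisfies Chen's relations (ii), (iii) -/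

section ImCharacter

variable {H : Type} [CommRing H] [Algebra ℚ H] {J : List Bool → H}

/-- `(-1)^j = (-1)^{i+j} (-1)^i`. [folklore] -/
theorem neg_one_pow_eq_of_add {R : Type*} [CommMonoid R] [HasDistribNeg R] {m i j : ℕ}
    (h : i + j = m) : (-1 : R) ^ j = (-1) ^ m * (-1) ^ i := by
  rw [← h, pow_add, mul_comm ((-1 : R) ^ i) ((-1) ^ j), mul_assoc, ← pow_add, ← two_mul, pow_mul,
    neg_one_sq, one_pow, mul_one]

/-- **(ii) for `Iᵐ` with arbitrary endpoints.** If `J = Iᵐ(0; ·; 1)` is a character of the shuffle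
algebra `𝒪(₀Π₁)`, then for all endpoints `a, b ∈ {0,1}` Brown's `Iᵐ(a; ·; b)` (defined from `J` by
I0, I1, I3) is again a shuffle character: `Iᵐ(a;u;b) Iᵐ(a;v;b) = Σ_{s ∈ u ш v} Iᵐ(a;s;b)` (for
`a = b` both sides vanish on non-empty words by I0; for `(a,b) = (1,0)` it is I3 and the reversal
symmetry of `ш`). [cite: Brown2012, §2.4 I0–I3 and (2.18) "rewritten in terms of 𝒪(₀Π₁) only"] -/
theorem Im_mul (hJ1 : J [] = 1)
    (hJmul : ∀ u v : List Bool, J u * J v = ((shuffleWord u v).map J).sum)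
    (a b : Bool) (u v : List Bool) :
    Im J a u b * Im J a v b = ((shuffleWord u v).map fun s => Im J a s b).sum := by
  rcases u with _ | ⟨c, u'⟩
  · simp [hJ1]
  rcases v with _ | ⟨d, v'⟩
  · simp [hJ1]
  have hne : ∀ s ∈ shuffleWord (c :: u') (d :: v'), s ≠ [] := fun s hs h => by
    have := length_of_mem_shuffleWord _ _ hs
    rw [h] at this
    simp at this
  by_cases hab : a = b
  · subst hab
    rw [Im_self J a (List.cons_ne_nil c u'), zero_mul, eq_comm]
    exact List.sum_eq_zero fun x hx => by
      obtain ⟨s, hs, rfl⟩ := List.mem_map.1 hx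
      exact Im_self J a (hne s hs)
  cases a <;> cases b
  · exact absurd rfl hab
  · simp only [Im_false_true]
    exact hJmul _ _
  · simp only [Im_true_false]
    rw [smul_mul_smul_comm, ← pow_add, hJmul,
      ((shuffleWord_reverse_perm (c :: u') (d :: v')).map J).sum_eq, List.map_map, List.smul_sum,
      List.map_map]
    refine congrArg List.sum (List.map_congr_left fun s hs => ?_)
    simp only [Function.comp_apply]
    rw [length_of_mem_shuffleWord _ _ hs, List.length_cons, List.length_cons]
  · exact absurd rfl hab

/-- **(iii) for `Iᵐ` with arbitrary endpoints** (composition of paths): for a shuffle character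
`J = Iᵐ(0; ·; 1)` and all `a, y, b ∈ {0,1}`,
`Σ_{w = w₁ w₂} Iᵐ(a; w₁; y) Iᵐ(y; w₂; b) = Iᵐ(a; w; b)`. For `a = y` or `y = b` all terms but one
vanish by I0; for `a = b ≠ y` the right side is `0` (I0) and the left side is the antipode identity
`Σ_{w = uv} (-1)^{|u|} ũ ш v = 0` of the shuffle Hopf algebra (through I3).
[cite: Brown2012, §2.4 I0–I3; Reutenauer1993, §1.6] -/
theorem Im_path (hJ1 : J [] = 1)
    (hJmul : ∀ u v : List Bool, J u * J v = ((shuffleWord u v).map J).sum)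
    (a y b : Bool) (w : List Bool) :
    ∑ k ∈ Finset.range (w.length + 1), Im J a (w.take k) y * Im J y (w.drop k) b = Im J a w b := by
  by_cases hw : w = []
  · subst hw
    simp [hJ1]
  have htake : ∀ k, k ≠ 0 → w.take k ≠ [] := fun k hk h => by
    rcases List.take_eq_nil_iff.1 h with h' | h'
    · exact hk h'
    · exact hw h'
  have hdrop : ∀ k, k < w.length → w.drop k ≠ [] := fun k hk h => by
    rw [List.drop_eq_nil_iff] at h
    omega
  have hleft : ∀ a b : Bool, ∑ k ∈ Finset.range (w.length + 1),
      Im J a (w.take k) a * Im J a (w.drop k) b = Im J a w b := by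
    intro a b
    rw [Finset.sum_eq_single_of_mem 0 (Finset.mem_range.2 (Nat.succ_pos _))]
    · rw [List.take_zero, List.drop_zero, Im_nil, hJ1, one_mul]
    · intro k _ hk0
      rw [Im_self J a (htake k hk0), zero_mul]
  have hright : ∀ a b : Bool, ∑ k ∈ Finset.range (w.length + 1),
      Im J a (w.take k) b * Im J b (w.drop k) b = Im J a w b := by
    intro a b
    rw [Finset.sum_eq_single_of_mem w.length (Finset.mem_range.2 (Nat.lt_succ_self _))]
    · rw [List.take_length, List.drop_length, Im_nil, hJ1, mul_one]
    · intro k hk hkw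
      have hk' : k < w.length := lt_of_le_of_ne (Nat.lt_succ_iff.1 (Finset.mem_range.1 hk)) hkw
      rw [Im_self J b (hdrop k hk'), mul_zero]
  have hl : ∀ k, (w.take k).length + (w.drop k).length = w.length := fun k => by
    rw [← List.length_append, List.take_append_drop]
  -- the two antipode cases `a = b ≠ y`
  have hanti₁ : ∑ k ∈ Finset.range (w.length + 1),
      Im J true (w.take k) false * Im J false (w.drop k) true = 0 := by
    simp only [Im_true_false, Im_false_true]
    have h := NCSeries.sum_splits_shPair_reverse w.length w (J : NCSeries Bool H) le_rfl
    rw [if_neg hw, NCSeries.sum_splits_eq_sum_range w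
      (fun p => (-1 : H) ^ p.1.length * NCSeries.shPair J p.1.reverse p.2)] at h
    refine Eq.trans (Finset.sum_congr rfl fun k _ => ?_) h
    rw [smul_mul_assoc, hJmul, Algebra.smul_def, map_pow, map_neg, map_one]
    rfl
  have hanti₂ : ∑ k ∈ Finset.range (w.length + 1),
      Im J false (w.take k) true * Im J true (w.drop k) false = 0 := by
    simp only [Im_true_false, Im_false_true]
    have h := NCSeries.sum_splits_shPair_reverse w.length w
      ((J ∘ List.reverse : List Bool → H) : NCSeries Bool H) le_rfl
    rw [if_neg hw, NCSeries.sum_splits_eq_sum_range w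
      (fun p => (-1 : H) ^ p.1.length * NCSeries.shPair (J ∘ List.reverse) p.1.reverse p.2)] at h
    have hsh : ∀ u v : List Bool,
        NCSeries.shPair ((J ∘ List.reverse : List Bool → H) : NCSeries Bool H) u.reverse v =
          J u * J v.reverse := by
      intro u v
      have P := shuffleWord_reverse_perm u v.reverse
      rw [List.reverse_reverse] at P
      rw [NCSeries.shPair, (P.map (J ∘ List.reverse)).sum_eq, List.map_map, Function.comp_assoc,
        List.reverse_involutive.comp_self, Function.comp_id, hJmul]
    rw [← mul_zero ((-1 : H) ^ w.length), ← h, Finset.mul_sum]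
    refine Finset.sum_congr rfl fun k _ => ?_
    rw [hsh, mul_smul_comm, Algebra.smul_def, map_pow, map_neg, map_one,
      neg_one_pow_eq_of_add (R := H) (hl k), mul_assoc]
  cases a <;> cases y <;> cases b
  · exact hleft _ _
  · exact hleft _ _
  · rw [hanti₂, Im_self J false hw]
  · exact hright _ _
  · exact hright _ _
  · rw [hanti₁, Im_self J true hw]
  · exact hleft _ _
  · exact hleft _ _

end ImCharacter

/-! ## `coactionG ρ` is Goncharov's composite `conv`, hence multiplicative -/

section Coaction

open GoncharovFormalIteratedIntegrals (splittings gapProdF conv conv_shuffle WordSeries.ext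
  WordSeries.mul_apply WordSeries.delta WordSeries.tensor)
open GoncharovFormalIteratedIntegrals renaming phi → phiK, phi_apply → phiK_apply

/-- `𝒰 ⊗ 𝒪(₀Π₁)` as a `ℚ`-algebra, through `ℚ → 𝒰 → 𝒰 ⊗ 𝒪(₀Π₁)` (`Algebra.compHom`). The tree's
`UShuffle` is a `𝒰`-algebra and carries no `ℚ`-module structure; this DEFINITION (not an
instance: it is only installed with `letI` inside the bodies and proofs below) lets us speak of
Brown's `Im J` for `J` with values in `𝒰 ⊗ 𝒪(₀Π₁)`. [folklore] -/
abbrev ratAlgebraUShuffle : Algebra ℚ UShuffle :=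
  Algebra.compHom UShuffle (algebraMap ℚ UAlg)

variable (ρ : List Bool → UAlg)

/-- The word `c` itself, as the element `1 ⊗ c` of `𝒰 ⊗ 𝒪(₀Π₁)`. [folklore] -/
def wordU (c : List Bool) : UShuffle := e () c

/-- `1 ⊗ ∅ = 1`. [folklore] -/
theorem wordU_nil : wordU [] = 1 := rfl

/-- `c ↦ 1 ⊗ c` is a shuffle character ((2.1): the product of `𝒪(₀Π₁)` is the shuffle product).
[cite: Brown2012, (2.1)] -/
theorem wordU_mul (u v : List Bool) : wordU u * wordU v = ((shuffleWord u v).map wordU).sum := by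
  rw [wordU, wordU, e_mul_e]
  rfl

/-- Goncharov's LEFT family for Theorem 2.4 read "in terms of `𝒪(₀Π₁)` only": the kept word
`Iᵐ(a; c; b) ↦ 1 ⊗ Iᵐ(a;c;b)`, reduced to `𝒪(₀Π₁)` by I0, I1, I3. [cite: Brown2012, §2.4, (2.18)] -/
def keptFamily (a : Bool) (c : List Bool) (b : Bool) : UShuffle :=
  letI := ratAlgebraUShuffle
  Im wordU a c b

/-- Goncharov's RIGHT family: a gap `Iᵐ(a; g; b) ↦ ρ(Iᵐ(a;g;b)) ⊗ 1`, i.e. `Im ρ` seen in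
`𝒰 ⊗ 𝒪(₀Π₁)`. [cite: Brown2012, (2.5)–(2.6), (2.18)] -/
def gapFamily (a : Bool) (g : List Bool) (b : Bool) : UShuffle :=
  algebraMap UAlg UShuffle (Im ρ a g b)

/-- The tree's `gapProdF` of the right family is Brown's `galoisFactor` (same recursion).
[cite: Brown2012, Theorem 2.4 (2.18)] -/
theorem gapProdF_gapFamily : ∀ (x : Bool) (g : List Bool) (ps : List (Bool × List Bool)) (b : Bool),
    gapProdF (gapFamily ρ) x g ps b = algebraMap UAlg UShuffle (galoisFactor ρ x g ps b)
  | x, g, [], b => rfl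
  | x, g, p :: ps, b => by
    rw [gapProdF, galoisFactor, map_mul, gapProdF_gapFamily]
    rfl

/-- **`coactionG ρ` is Goncharov's composite** `conv J K` of the families `J = keptFamily`,
`K = gapFamily ρ` between the endpoints `0` and `1`: Theorem 2.4 (2.18) with the Galois factor on
the left is the coproduct formula [Goncharov2005, Thm 1.2 / (26)] read through `ρ ⊗ id`.
[cite: Brown2012, Theorem 2.4 (2.18); Goncharov2005, §2.1] -/
theorem coactionG_eq_conv (w : List Bool) :
    coactionG ρ w = conv keptFamily (gapFamily ρ) false w true := by
  letI := ratAlgebraUShuffle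
  rw [coactionG, conv]
  refine congrArg List.sum (List.map_congr_left fun sp _ => ?_)
  rw [gapProdF_gapFamily, keptFamily, Im_false_true, ← Algebra.commutes, ← Algebra.smul_def, wordU,
    smul_e, kept]

/-- (ii) for the left family. [cite: Brown2012, §2.4] -/
theorem keptFamily_mul (a b : Bool) (u v : List Bool) :
    keptFamily a u b * keptFamily a v b =
      ((shuffleWord u v).map fun s => keptFamily a s b).sum := by
  letI := ratAlgebraUShuffle
  exact Im_mul wordU_nil wordU_mul a b u v

variable {ρ}

/-- (ii) for the right family, as the identity `δ Φ_{a,b} = Φ_{a,b} ⊗ Φ_{a,b}` of generating series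
(`ρ` a shuffle character). [cite: Brown2012, §2.4; Goncharov2005, Prop 2.2] -/
theorem delta_phi_gapFamily (hρ1 : ρ [] = 1)
    (hρmul : ∀ u v : List Bool, ρ u * ρ v = ((shuffleWord u v).map ρ).sum) (a b : Bool) :
    WordSeries.delta (phiK (gapFamily ρ) a b) =
      WordSeries.tensor (phiK (gapFamily ρ) a b) (phiK (gapFamily ρ) a b) := by
  refine WordSeries.ext fun u => WordSeries.ext fun v => ?_
  show ((shuffleWord u v).map fun w => gapFamily ρ a w b).sum =
    gapFamily ρ a u b * gapFamily ρ a v b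
  simp only [gapFamily]
  rw [← map_mul, Im_mul hρ1 hρmul, map_list_sum, List.map_map]
  rfl

/-- (iii) for the right family, as the identity `Φ_{a,y} Φ_{y,b} = Φ_{a,b}` of generating series
(`ρ` a shuffle character). [cite: Brown2012, §2.4; Goncharov2005, Prop 2.2] -/
theorem phi_gapFamily_mul (hρ1 : ρ [] = 1)
    (hρmul : ∀ u v : List Bool, ρ u * ρ v = ((shuffleWord u v).map ρ).sum) (a y b : Bool) :
    phiK (gapFamily ρ) a y * phiK (gapFamily ρ) y b = phiK (gapFamily ρ) a b := by
  refine WordSeries.ext fun w => ?_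
  rw [WordSeries.mul_apply]
  simp only [phiK_apply, gapFamily, ← map_mul]
  rw [← map_sum, Im_path hρ1 hρmul]

/-- **The coaction written through a shuffle character is multiplicative** (the field
`coaction_mul` of `MotivicGaloisData` derived from `ρ_nil`, `ρ_mul`): Goncharov's coproduct
respects the shuffle relations [Goncharov2005, Prop. 2.2] (`conv_shuffle`), applied to the
families `keptFamily`, `gapFamily ρ`, which satisfy (ii), (ii)+(iii) by `Im_mul`, `Im_path`.
[cite: Brown2012, (2.5) and Theorem 2.4; Goncharov2005, Prop. 2.2] -/
theorem coactionG_mul (hρ1 : ρ [] = 1)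
    (hρmul : ∀ u v : List Bool, ρ u * ρ v = ((shuffleWord u v).map ρ).sum) (u v : List Bool) :
    coactionG ρ u * coactionG ρ v = ((shuffleWord u v).map (coactionG ρ)).sum := by
  rw [coactionG_eq_conv, coactionG_eq_conv, conv_shuffle keptFamily_mul
    (delta_phi_gapFamily hρ1 hρmul) (phi_gapFamily_mul hρ1 hρmul)]
  exact congrArg List.sum (List.map_congr_left fun w _ => (coactionG_eq_conv ρ w).symm)

end Coaction

/-! ## The bundle without the field `coaction_mul` -/

namespace MotivicGaloisData

open GoncharovFormalIteratedIntegrals (splittings)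

/-- **`MotivicGaloisData` from a graded shuffle character `ρ` whose Goncharov coaction is
coassociative, an even point `γ` and the period point `(g, t₀)`** — the multiplicativity of the
coaction being a theorem (`coactionG_mul`). [cite: Brown2012, §2.1 (2.5)–(2.6), Theorem 2.4;
Goncharov2005, Prop. 2.2] -/
def mk' (ρ : List Bool → UAlg) (ρ_nil : ρ [] = 1)
    (ρ_mul : ∀ u v : List Bool, ρ u * ρ v = ((shuffleWord u v).map ρ).sum)
    (ρ_mem : ∀ w : List Bool, ρ w ∈ uPrime w.length)
    (coaction_coassoc : ∀ (w : List Bool) (a : List ℕ),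
      ((splittings w).map fun sp =>
        (ShuffleMonoidAlgebra.single ((), kept sp.2)
          (prefixCoeff a (galoisFactor ρ false sp.1 sp.2 true)) : UShuffle)).sum =
      ((splittings w).map fun sp =>
        algebraMap ℚ UAlg (galoisFactor ρ false sp.1 sp.2 true (0, a)) •
          coactionG ρ (kept sp.2)).sum)
    (γ : List Bool → ℚ) (γ_nil : γ [] = 1)
    (γ_mul : ∀ u v : List Bool, γ u * γ v = ((shuffleWord u v).map γ).sum)
    (γ_odd : ∀ w : List Bool, Odd w.length → γ w = 0)
    (g : List ℕ → ℝ) (g_nil : g [] = 1)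
    (g_mul : ∀ a b : List ℕ, g a * g b = ((shuffleWord a b).map g).sum) (t₀ : ℝ)
    (period : ∀ s : List ℕ, IsAdmissible s →
      perLin g t₀ (Ψ ρ γ (rho s.reverse)) = multipleZeta s) :
    MotivicGaloisData where
  ρ := ρ
  ρ_nil := ρ_nil
  ρ_mul := ρ_mul
  ρ_mem := ρ_mem
  coaction_mul := coactionG_mul ρ_nil ρ_mul
  coaction_coassoc := coaction_coassoc
  γ := γ
  γ_nil := γ_nil
  γ_mul := γ_mul
  γ_odd := γ_odd
  g := g
  g_nil := g_nil
  g_mul := g_mul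
  t₀ := t₀
  period := period

/-- The smart constructor does not change `ρ`. [folklore] -/
@[simp] theorem mk'_ρ (ρ : List Bool → UAlg) (ρ_nil ρ_mul ρ_mem coaction_coassoc)
    (γ : List Bool → ℚ) (γ_nil γ_mul γ_odd) (g : List ℕ → ℝ) (g_nil g_mul) (t₀ : ℝ) (period) :
    (mk' ρ ρ_nil ρ_mul ρ_mem coaction_coassoc γ γ_nil γ_mul γ_odd g g_nil g_mul t₀ period).ρ = ρ :=
  rfl

end MotivicGaloisData

/-- **Brown's package from the reduced bundle**: a graded shuffle character `ρ : 𝒪(₀Π₁) → 𝒰'`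
with coassociative Goncharov coaction, an even rational point `γ` and a real period point
`(g, t₀)` matching the multiple zeta values on convergent words already yield an inhabitant of
`MotivicMZV` (multiplicativity of the coaction is proved, not assumed).
[cite: Brown2012, §§2.1–2.5, §3.1; Goncharov2005, Prop. 2.2] -/
theorem motivicMZV_nonempty_of_reducedGaloisData (ρ : List Bool → UAlg) (ρ_nil : ρ [] = 1)
    (ρ_mul : ∀ u v : List Bool, ρ u * ρ v = ((shuffleWord u v).map ρ).sum)
    (ρ_mem : ∀ w : List Bool, ρ w ∈ uPrime w.length)
    (coaction_coassoc : ∀ (w : List Bool) (a : List ℕ),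
      ((GoncharovFormalIteratedIntegrals.splittings w).map fun sp =>
        (ShuffleMonoidAlgebra.single ((), kept sp.2)
          (prefixCoeff a (galoisFactor ρ false sp.1 sp.2 true)) : UShuffle)).sum =
      ((GoncharovFormalIteratedIntegrals.splittings w).map fun sp =>
        algebraMap ℚ UAlg (galoisFactor ρ false sp.1 sp.2 true (0, a)) •
          coactionG ρ (kept sp.2)).sum)
    (γ : List Bool → ℚ) (γ_nil : γ [] = 1)
    (γ_mul : ∀ u v : List Bool, γ u * γ v = ((shuffleWord u v).map γ).sum)
    (γ_odd : ∀ w : List Bool, Odd w.length → γ w = 0)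
    (g : List ℕ → ℝ) (g_nil : g [] = 1)
    (g_mul : ∀ a b : List ℕ, g a * g b = ((shuffleWord a b).map g).sum) (t₀ : ℝ)
    (period : ∀ s : List ℕ, IsAdmissible s →
      perLin g t₀ (Ψ ρ γ (rho s.reverse)) = multipleZeta s) :
    motivicMZV_nonempty :=
  ⟨(MotivicGaloisData.mk' ρ ρ_nil ρ_mul ρ_mem coaction_coassoc γ γ_nil γ_mul γ_odd g g_nil g_mul
    t₀ period).toMotivicMZV⟩

end Brown2012

end Literature.NumberTheory.Transcendental
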